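import Literature.MathematicalPhysics.QuantumFieldTheory.Balaban1983to89.B6Partition118KLevelTorus
import Literature.MathematicalPhysics.QuantumFieldTheory.Balaban1983to89.B6Eq238MultiLevelTorus

/-!
# `Balaban1983to89.B6Partition118KLevelTorusChart` — T. Bałaban, *Propagators and renormalization transformations for lattice gauge theories. II*,
# Commun. Math. Phys. **96** (1984) 223–250 [Balaban1984PropagatorsII], (2.36) p. 229 with [Balaban1984PropagatorsI] (1.118) p. 36: THE CHART DICTIONARY OF
# THE PERIODIC PARTITION `{h^T_□}` OF `T_η` — read in ANY translation chart `s` (p21's `D.chart s`), a cube whose centre is `(S_□ + S_k/2)`-deep IS the box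
# cube of gen 25's `…B6Partition118KLevelFine`: `hF (D.chart s).toDomains □ (σ_s⁻¹ z) = hT D (cT s □) z` (file 2 of route (A) of B6-CLOSURE §5 item 11 /
# GAPS G-B6-p38-04; file 1 `…B6Partition118KLevelTorus` = the periodic family, file 3 `…TorusBinders` = the (2.134) binders in the torus metric)

statement-level skeleton of published theorems with citation tags; proofs where landed; nothing here is a claim about the Yang–Mills mass gap

PDF held: `paper:balaban1984-cmp96-propagators-rt-ii` (journal page = PDF page + 222): p. 224 [PDF 2] ((2.1)), p. 229 [PDF 7] ((2.36): *"a family 𝒟 of cubes □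
of different sizes and such that T_η = ⋃_{□∈𝒟} □ … Σ_{□∈𝒟} h_□² = 1"*), p. 247 [PDF 25] ((2.134)); [Balaban1984PropagatorsI] (1.118) p. 36 — read from the tree
transcriptions in `…B6Cover236MultiLevelBlocks`, `…B6Eq238MultiLevelTorus` (p21: *"every torus cube is a CENTRAL box cube of a translated family"*).

CITATION HEADER (lean-in-tree rule) — WHAT IS REPRODUCED.  Phase-2 file of the `lit-balaban` typed skeleton (HOME `run/shared/lean/pub/lit-balaban/`), seat
**p38 gen 26**; SKELETON rows **B6.Eq2.36** × **B5.Eq1.118** × **B6.Eq2.91/2.134** (cells only; decls of record untouched; owner r03, referee ref-4).  File 1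
built the periodic family `thetaT`/`nsqT`/`hT` on the torus intrinsically; gen 25 built `thetaF`/`nsqF`/`hF` and ALL the (2.134) sizes on the box of any
`Domains`.  THIS FILE proves that the two agree cube by cube in every translation chart (p21's device of `…B6Eq238MultiLevelTorus`, here for the
big-block-centred cubes of `…B6Cover236MultiLevelBlocks` and WITHOUT any level-window/(2.2) argument):
* the label transport `cT s (j, β) = (j, (β + L^{k−j}s) mod P_j)` of the chart `s` (torus translation `σ_s` by `(M·L^k)·s`) is a BIJECTION
  `cubes (D.chart s).toDomains ≃ cubes D.toDomains` (`cT_mem`, `cTinv_mem`, `cubesEquiv`; p21's `blk_twrap_add`);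
* the congruence `(σ_s w)_μ − ctr^T_μ ≡ w_μ − ctr_μ (mod N₀_μ)` (`tshift_sub_ctrT`, `thetaT_cT_tshift`);
* **`thetaF_chart_eq_thetaT`**: the box bump of a chart cube at `w` IS the periodic bump of the transported cube at `σ_s w` whenever `|w_μ − ctr_μ| ≤ N₀_μ − S`
  in every coordinate (file 1's one-variable lemma `hprof_circR_eq`; `P_μ ≥ 2`) — which holds at every `S/2`-deep site for every cube (`abs_sub_ctr_le_of_deep`)
  and at EVERY site for a cube whose centre lies in `[S, N₀ − S]` (`abs_sub_ctr_le_of_ctr`);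
* **`nsqF_chart_eq_nsqT`**: the normalising sums agree at every `S_k/2`-deep chart site (term by term along `cubesEquiv`; all cubes have `S ≤ S_k`);
* **`hF_chart_eq_hT`** / **`hT_eq_hF_chart_symm`**: for a cube with `CtrDeep` (centre `(S + S_k/2)`-deep) `hF (D.chart s).toDomains □ w = hT D (cT s □) (σ_s w)`
  for ALL `w` — every box-side statement of gen 25 about such a cube is a statement about the periodic family (file 3 transports the (2.134) binders through
  gen 25's `…B6TorusDepthDistance.lip_transfer`/`gap_transfer`; p21's central cube `(j, qc)` of the chart `svec` is `CtrDeep` for `P_μ ≥ 5`).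
No `def : Prop`, no new fact; defs with bodies (`cT`, `cTinv`, `cubesEquiv`, `CtrDeep`); standard axioms.
HONEST SCOPE. Pure lattice bookkeeping on the integer torus `Π_μ[0, N₀_μ)`, `N₀ = M·L^k·P`, `P_μ ≥ 2`; the depth of a concrete cube is the consumer's input
(any chart in which the cube is that deep will do); nothing analytic beyond file 1's one-variable lemma; NOT summit progress.  Unit `lit-balaban-p38`
(gen 26), 2026-08-23.
-/

namespace Literature.MathematicalPhysics.QuantumFieldTheory.Balaban1983to89.B6Partition118KLevelTorusChart

open Finset
open Literature.MathematicalPhysics.QuantumFieldTheory.Balaban1983to89.B4Reflection242 (boxDom mem_boxDom blk blk_mem_boxDom)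
open Literature.MathematicalPhysics.QuantumFieldTheory.Balaban1983to89.B6MultiLevelBoxOperator (Domains N0 bigSide bigSide_eq one_le_bigSide)
open Literature.MathematicalPhysics.QuantumFieldTheory.Balaban1983to89.B6MultiLevelTorusOperator
  (TDomains twrap twrap_mem twrap_eq_self twrap_twrap_add tshift tshift_val blk_twrap_add N0_eq_bigSide_mul)
open Literature.MathematicalPhysics.QuantumFieldTheory.Balaban1983to89.B6Geom246MultiLevelBox (bset blkOf toR)
open Literature.MathematicalPhysics.QuantumFieldTheory.Balaban1983to89.B6Cover236MultiLevelBlocks (cubes side side_eq side_pos ctr)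
open Literature.MathematicalPhysics.QuantumFieldTheory.Balaban1983to89.B6Eq238MultiLevelBox (Pj one_le_Pj)
open Literature.MathematicalPhysics.QuantumFieldTheory.Balaban1983to89.B6Eq238MultiLevelTorus (rj one_le_rj bigSide_k_eq N0_eq_mul_Pj)
open Literature.MathematicalPhysics.QuantumFieldTheory.Balaban1983to89.B4PartitionUnity22 (hprof)
open Literature.MathematicalPhysics.QuantumFieldTheory.Balaban1983to89.B6Partition118KLevelFine (sF thetaF dist_lt_of_thetaF_ne_zero nsqF hF)
open Literature.MathematicalPhysics.QuantumFieldTheory.Balaban1983to89.B6Partition118KLevelTorus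

variable {d : ℕ}

/-! ## The chart dictionary: every translation chart reads the periodic family as gen 25's box family, cube by deep cube -/

section Chart

variable {ℓ Mh k R : ℕ} {P : Fin (d + 1) → ℕ}

/-- the label of an active big block lies in the periodic label box `Π_μ[0, P_j)`, `P_j = L^{k−j}P`. [cite: Balaban1984PropagatorsII, (2.1) p.224, bookkeeping] -/
theorem label_mem_boxDom (D' : Domains d ℓ Mh k P R) (hMh : 1 ≤ Mh) {c : ℕ × (Fin (d + 1) → ℤ)} (hc : c ∈ cubes D') :
    c.2 ∈ boxDom (Pj ℓ k P c.1) := by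
  unfold cubes at hc
  obtain ⟨x, hx, rfl⟩ := Finset.mem_image.1 hc
  dsimp only
  have hjk : D'.lev x ≤ k := D'.lev_le x
  have hN : N0 ℓ Mh k P = fun μ => bigSide ℓ Mh (D'.lev x) * Pj ℓ k P (D'.lev x) μ :=
    funext fun μ => by rw [N0_eq_mul_Pj hjk μ, bigSide_eq]; ring
  rw [hN] at hx
  exact blk_mem_boxDom (one_le_bigSide hMh _) hx

/-- **THE CENTRE OF AN ACTIVE BIG BLOCK LIES IN `[S/2, N₀ − S/2]`** in every coordinate. [cite: Balaban1984PropagatorsII, (2.1) p.224, bookkeeping] -/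
theorem ctr_bounds (D' : Domains d ℓ Mh k P R) (hMh : 1 ≤ Mh) (i : ↥(cubes D')) (μ : Fin (d + 1)) :
    side D' i / 2 ≤ ctr D' i μ ∧ ctr D' i μ + side D' i / 2 ≤ N0 ℓ Mh k P μ := by
  have hjk : i.1.1 ≤ k := by
    obtain ⟨x, _, hx⟩ := Finset.mem_image.1 i.2
    rw [← hx]; exact D'.lev_le x
  obtain ⟨h0, h1⟩ := (mem_boxDom.1 (label_mem_boxDom D' hMh i.2)) μ
  have h1' : i.1.2 μ + 1 ≤ (Pj ℓ k P i.1.1 μ : ℤ) := by omega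
  have h0r : (0 : ℝ) ≤ (i.1.2 μ : ℝ) := by exact_mod_cast h0
  have h1r : (i.1.2 μ : ℝ) + 1 ≤ (Pj ℓ k P i.1.1 μ : ℝ) := by exact_mod_cast h1'
  have hS : 0 < side D' i := side_pos D' hMh i
  have eN : (N0 ℓ Mh k P μ : ℝ) = side D' i * (Pj ℓ k P i.1.1 μ : ℝ) := by
    rw [N0_eq_mul_Pj hjk μ, side_eq]; push_cast; ring
  have ec : ctr D' i μ = ((i.1.2 μ : ℝ) + 1 / 2) * side D' i := rfl
  rw [ec, eN]
  constructor <;> nlinarith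

/-- **THE LABEL TRANSPORT OF THE CHART `s`**: the big block `(j, β)` of the chart `D.chart s` is the big block `(j, (β + L^{k−j}s) mod P_j)` of the torus
(the chart is the torus translation by `(M·L^k)·s = S_j·(L^{k−j}s)`). [cite: Balaban1984PropagatorsII, (2.36) p.229 with (2.1) p.224, dictionary (charts)] -/
def cT (ℓ k : ℕ) (P : Fin (d + 1) → ℕ) (s : Fin (d + 1) → ℤ) (c : ℕ × (Fin (d + 1) → ℤ)) : ℕ × (Fin (d + 1) → ℤ) :=
  (c.1, twrap (Pj ℓ k P c.1) (c.2 + fun μ => (rj ℓ k c.1 : ℤ) * s μ))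

/-- the inverse label transport. [cite: Balaban1984PropagatorsII, (2.36) p.229 with (2.1) p.224, dictionary (charts)] -/
def cTinv (ℓ k : ℕ) (P : Fin (d + 1) → ℕ) (s : Fin (d + 1) → ℤ) (c : ℕ × (Fin (d + 1) → ℤ)) : ℕ × (Fin (d + 1) → ℤ) :=
  (c.1, twrap (Pj ℓ k P c.1) (c.2 - fun μ => (rj ℓ k c.1 : ℤ) * s μ))

variable {D : TDomains d ℓ Mh k P R}

/-- the big `j`-block label of a translated site: `blk_{S_j}(σ_{±s} x) = (blk_{S_j} x ± L^{k−j}s) mod P_j` (`j ≤ k`).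
[cite: Balaban1984PropagatorsII, (2.1) p.224, dictionary (charts)] -/
theorem blk_bigSide_tshift (hMh : 1 ≤ Mh) (hP : ∀ μ, 1 ≤ P μ) {j : ℕ} (hjk : j ≤ k) (t : Fin (d + 1) → ℤ)
    (x : ↥(boxDom (N0 ℓ Mh k P))) :
    blk (bigSide ℓ Mh j) (tshift (N0 ℓ Mh k P) (TDomains.tvec ℓ Mh k t) x).1 =
      twrap (Pj ℓ k P j) (blk (bigSide ℓ Mh j) x.1 + fun μ => (rj ℓ k j : ℤ) * t μ) := by
  funext μ
  rw [tshift_val]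
  have hN : ∀ i, N0 ℓ Mh k P i = bigSide ℓ Mh j * Pj ℓ k P j i := fun i => by rw [N0_eq_mul_Pj hjk i, bigSide_eq]; ring
  have ht : ∀ i, TDomains.tvec ℓ Mh k t i = (bigSide ℓ Mh j : ℤ) * ((rj ℓ k j : ℤ) * t i) := fun i => by
    simp only [TDomains.tvec, bigSide_k_eq (ℓ := ℓ) (Mh := Mh) hjk, bigSide_eq]; push_cast; ring
  rw [blk_twrap_add (one_le_bigSide hMh j) hN (one_le_Pj hP j) ht x.1 μ]
  rfl

/-- **THE LABEL TRANSPORT MAPS CHART CUBES TO TORUS CUBES.** [cite: Balaban1984PropagatorsII, (2.36) p.229, dictionary (charts)] -/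
theorem cT_mem (hMh : 1 ≤ Mh) (hP : ∀ μ, 1 ≤ P μ) (s : Fin (d + 1) → ℤ) {c : ℕ × (Fin (d + 1) → ℤ)} (hc : c ∈ cubes (D.chart s).toDomains) :
    cT ℓ k P s c ∈ cubes D.toDomains := by
  unfold cubes at hc ⊢
  obtain ⟨x, hx, rfl⟩ := Finset.mem_image.1 hc
  set z := tshift (N0 ℓ Mh k P) (TDomains.tvec ℓ Mh k s) ⟨x, hx⟩ with hz
  have hlev : (D.chart s).toDomains.lev x = D.lev z.1 := D.chart_lev s ⟨x, hx⟩
  refine Finset.mem_image.2 ⟨z.1, z.2, ?_⟩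
  unfold cT
  dsimp only
  rw [hlev, TDomains.toDomains_lev]
  refine Prod.ext rfl ?_
  dsimp only
  rw [hz, blk_bigSide_tshift hMh hP (D.lev_le _) s ⟨x, hx⟩]

/-- … and the inverse transport maps torus cubes to chart cubes. [cite: Balaban1984PropagatorsII, (2.36) p.229, dictionary (charts)] -/
theorem cTinv_mem (hMh : 1 ≤ Mh) (hP : ∀ μ, 1 ≤ P μ) (s : Fin (d + 1) → ℤ) {c : ℕ × (Fin (d + 1) → ℤ)} (hc : c ∈ cubes D.toDomains) :
    cTinv ℓ k P s c ∈ cubes (D.chart s).toDomains := by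
  unfold cubes at hc ⊢
  obtain ⟨z, hz, rfl⟩ := Finset.mem_image.1 hc
  set x := (tshift (N0 ℓ Mh k P) (TDomains.tvec ℓ Mh k s)).symm ⟨z, hz⟩ with hx
  have hlev : (D.chart s).toDomains.lev x.1 = D.lev z := by
    rw [TDomains.toDomains_lev, D.chart_lev s x, hx, Equiv.apply_symm_apply]
  refine Finset.mem_image.2 ⟨x.1, x.2, ?_⟩
  unfold cTinv
  rw [hlev, TDomains.toDomains_lev]
  refine Prod.ext rfl ?_
  dsimp only
  rw [hx, B6MultiLevelTorusOperator.tshift_symm_apply]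
  have e : -TDomains.tvec ℓ Mh k s = TDomains.tvec ℓ Mh k (-s) := funext fun i => by simp [TDomains.tvec]
  rw [e, blk_bigSide_tshift hMh hP (D.lev_le _) (-s) ⟨z, hz⟩]
  congr 1
  funext μ
  simp only [Pi.add_apply, Pi.sub_apply, Pi.neg_apply]
  ring

/-- `cT ∘ cTinv = id` on torus cubes. [cite: Balaban1984PropagatorsII, (2.36) p.229, dictionary (charts)] -/
theorem cT_cTinv (hMh : 1 ≤ Mh) (s : Fin (d + 1) → ℤ) {c : ℕ × (Fin (d + 1) → ℤ)} (hc : c ∈ cubes D.toDomains) :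
    cT ℓ k P s (cTinv ℓ k P s c) = c := by
  have hlab := label_mem_boxDom D.toDomains hMh hc
  unfold cT cTinv
  refine Prod.ext rfl ?_
  dsimp only
  rw [twrap_twrap_add]
  have e : (c.2 - fun μ => (rj ℓ k c.1 : ℤ) * s μ) + (fun μ => (rj ℓ k c.1 : ℤ) * s μ) = c.2 := by funext μ; simp
  rw [e, twrap_eq_self hlab]

/-- `cTinv ∘ cT = id` on chart cubes. [cite: Balaban1984PropagatorsII, (2.36) p.229, dictionary (charts)] -/
theorem cTinv_cT (hMh : 1 ≤ Mh) (s : Fin (d + 1) → ℤ) {c : ℕ × (Fin (d + 1) → ℤ)} (hc : c ∈ cubes (D.chart s).toDomains) :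
    cTinv ℓ k P s (cT ℓ k P s c) = c := by
  have hlab := label_mem_boxDom (D.chart s).toDomains hMh hc
  unfold cT cTinv
  refine Prod.ext rfl ?_
  dsimp only
  rw [sub_eq_add_neg, twrap_twrap_add]
  have e : (c.2 + fun μ => (rj ℓ k c.1 : ℤ) * s μ) + -(fun μ => (rj ℓ k c.1 : ℤ) * s μ) = c.2 := by funext μ; simp
  rw [e, twrap_eq_self hlab]

variable (D)

/-- **THE CHART CUBES ARE THE TORUS CUBES**: the label transport as an equivalence `cubes (D.chart s).toDomains ≃ cubes D.toDomains`.
[cite: Balaban1984PropagatorsII, (2.36) p.229 («a family 𝒟 of cubes □ … such that T_η = ⋃_{□∈𝒟} □»), dictionary (charts)] -/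
noncomputable def cubesEquiv (hMh : 1 ≤ Mh) (hP : ∀ μ, 1 ≤ P μ) (s : Fin (d + 1) → ℤ) : ↥(cubes (D.chart s).toDomains) ≃ ↥(cubes D.toDomains) where
  toFun i := ⟨cT ℓ k P s i.1, cT_mem hMh hP s i.2⟩
  invFun c := ⟨cTinv ℓ k P s c.1, cTinv_mem hMh hP s c.2⟩
  left_inv i := Subtype.ext (cTinv_cT hMh s i.2)
  right_inv c := Subtype.ext (cT_cTinv hMh s c.2)

/-- the value of the equivalence. [cite: Balaban1984PropagatorsII, (2.36) p.229, dictionary (charts)] -/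
@[simp] theorem cubesEquiv_apply_val (hMh : 1 ≤ Mh) (hP : ∀ μ, 1 ≤ P μ) (s : Fin (d + 1) → ℤ) (i : ↥(cubes (D.chart s).toDomains)) :
    (cubesEquiv D hMh hP s i).1 = cT ℓ k P s i.1 := rfl

variable {D}

/-- **THE CONGRUENCE `(σ_s w)_μ − ctr^T_μ ≡ w_μ − ctr_μ (mod N₀_μ)`**: the torus coordinate of a chart site minus the centre of the transported big block differs
from the chart coordinate minus the chart centre by a period. [cite: Balaban1984PropagatorsII, (2.36) p.229 with (2.1) p.224, dictionary (charts)] -/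
theorem tshift_sub_ctrT (s : Fin (d + 1) → ℤ) {c : ℕ × (Fin (d + 1) → ℤ)} (hjk : c.1 ≤ k)
    (w : ↥(boxDom (N0 ℓ Mh k P))) (μ : Fin (d + 1)) :
    ∃ m : ℤ, ((tshift (N0 ℓ Mh k P) (TDomains.tvec ℓ Mh k s) w).1 μ : ℝ) - (((cT ℓ k P s c).2 μ : ℝ) + 1 / 2) * (bigSide ℓ Mh c.1 : ℝ)
      = ((w.1 μ : ℝ) - ((c.2 μ : ℝ) + 1 / 2) * (bigSide ℓ Mh c.1 : ℝ)) + (N0 ℓ Mh k P μ : ℝ) * m := by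
  have hN : N0 ℓ Mh k P μ = bigSide ℓ Mh c.1 * Pj ℓ k P c.1 μ := by
    rw [N0_eq_mul_Pj hjk μ, bigSide_eq]; ring
  have ht : TDomains.tvec ℓ Mh k s μ = (bigSide ℓ Mh c.1 : ℤ) * ((rj ℓ k c.1 : ℤ) * s μ) := by
    simp only [TDomains.tvec, bigSide_k_eq (ℓ := ℓ) (Mh := Mh) hjk, bigSide_eq]; push_cast; ring
  have hNr : ((N0 ℓ Mh k P μ : ℕ) : ℝ) = (bigSide ℓ Mh c.1 : ℝ) * (Pj ℓ k P c.1 μ : ℝ) := by exact_mod_cast hN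
  have htr : ((TDomains.tvec ℓ Mh k s μ : ℤ) : ℝ) = (bigSide ℓ Mh c.1 : ℝ) * ((rj ℓ k c.1 : ℝ) * (s μ : ℝ)) := by exact_mod_cast ht
  -- the two reductions modulo the periods
  obtain ⟨m₁, hm₁⟩ : ∃ m₁ : ℤ, (tshift (N0 ℓ Mh k P) (TDomains.tvec ℓ Mh k s) w).1 μ =
      w.1 μ + TDomains.tvec ℓ Mh k s μ + (N0 ℓ Mh k P μ : ℤ) * m₁ :=
    ⟨-((w.1 μ + TDomains.tvec ℓ Mh k s μ) / (N0 ℓ Mh k P μ : ℤ)), by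
      rw [tshift_val]
      show (w.1 μ + TDomains.tvec ℓ Mh k s μ) % (N0 ℓ Mh k P μ : ℤ) = _
      rw [Int.emod_def]; ring⟩
  obtain ⟨m₂, hm₂⟩ : ∃ m₂ : ℤ, (cT ℓ k P s c).2 μ = c.2 μ + (rj ℓ k c.1 : ℤ) * s μ + (Pj ℓ k P c.1 μ : ℤ) * m₂ :=
    ⟨-((c.2 μ + (rj ℓ k c.1 : ℤ) * s μ) / (Pj ℓ k P c.1 μ : ℤ)), by
      unfold cT
      show (c.2 μ + (rj ℓ k c.1 : ℤ) * s μ) % (Pj ℓ k P c.1 μ : ℤ) = _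
      rw [Int.emod_def]; ring⟩
  refine ⟨m₁ - m₂, ?_⟩
  rw [hm₁, hm₂]
  push_cast at hNr ⊢
  linear_combination htr + (m₂ : ℝ) * hNr

/-- **THE PERIODIC BUMP OF THE TRANSPORTED CUBE AT THE TRANSLATED SITE** is the product of `hprof(dist(w_μ − ctr_μ, N₀_μℤ)/(8S/5))` over the CHART
coordinates. [cite: Balaban1984PropagatorsII, (2.36) p.229, dictionary (charts)] -/
theorem thetaT_cT_tshift (hMh : 1 ≤ Mh) (hP : ∀ μ, 1 ≤ P μ) (s : Fin (d + 1) → ℤ) {c : ℕ × (Fin (d + 1) → ℤ)} (hjk : c.1 ≤ k)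
    (w : ↥(boxDom (N0 ℓ Mh k P))) :
    thetaT ℓ Mh (N0 ℓ Mh k P) (cT ℓ k P s c) (tshift (N0 ℓ Mh k P) (TDomains.tvec ℓ Mh k s) w).1 =
      ∏ μ, hprof (circR (N0 ℓ Mh k P μ) ((w.1 μ : ℝ) - ((c.2 μ : ℝ) + 1 / 2) * (bigSide ℓ Mh c.1 : ℝ)) / (8 / 5 * (bigSide ℓ Mh c.1 : ℝ))) := by
  unfold thetaT
  refine Finset.prod_congr rfl fun μ _ => ?_
  obtain ⟨m, hm⟩ := tshift_sub_ctrT s hjk w μ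
  have e1 : (cT ℓ k P s c).1 = c.1 := rfl
  rw [e1, hm, circR_add_mul (B6MultiLevelTorusOperator.one_le_N0 hMh hP μ)]

/-- **THE BOX BUMP OF A CHART CUBE IS THE PERIODIC BUMP OF THE TRANSPORTED CUBE** at every chart site `w` with `|w_μ − ctr_μ| ≤ N₀_μ − S` in every coordinate
(`P_μ ≥ 2`, so that `2S ≤ N₀`). [cite: Balaban1984PropagatorsII, (2.36) p.229; Balaban1984PropagatorsI, (1.118) p.36] -/
theorem thetaF_chart_eq_thetaT (hMh : 1 ≤ Mh) (hP2 : ∀ μ, 2 ≤ P μ) (s : Fin (d + 1) → ℤ) (i : ↥(cubes (D.chart s).toDomains))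
    (w : ↥(boxDom (N0 ℓ Mh k P))) (hw : ∀ μ, |(w.1 μ : ℝ) - ctr (D.chart s).toDomains i μ| ≤ (N0 ℓ Mh k P μ : ℝ) - side (D.chart s).toDomains i) :
    thetaF (D.chart s).toDomains i (toR w.1) = thetaT ℓ Mh (N0 ℓ Mh k P) (cT ℓ k P s i.1) (tshift (N0 ℓ Mh k P) (TDomains.tvec ℓ Mh k s) w).1 := by
  have hP : ∀ μ, 1 ≤ P μ := fun μ => le_trans (by norm_num) (hP2 μ)
  have hjk : i.1.1 ≤ k := by
    obtain ⟨x, _, hx⟩ := Finset.mem_image.1 i.2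
    rw [← hx]; exact (D.chart s).toDomains.lev_le x
  rw [thetaT_cT_tshift hMh hP s hjk w]
  unfold thetaF
  refine Finset.prod_congr rfl fun μ _ => ?_
  have hS : 0 < side (D.chart s).toDomains i := side_pos _ hMh i
  have eS : (bigSide ℓ Mh i.1.1 : ℝ) = side (D.chart s).toDomains i := rfl
  have ec : ((i.1.2 μ : ℝ) + 1 / 2) * (bigSide ℓ Mh i.1.1 : ℝ) = ctr (D.chart s).toDomains i μ := rfl
  have esF : sF (D.chart s).toDomains i = 8 / 5 * side (D.chart s).toDomains i := rfl
  have ew : toR w.1 μ = (w.1 μ : ℝ) := rfl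
  have h2S : 2 * side (D.chart s).toDomains i ≤ (N0 ℓ Mh k P μ : ℝ) := by
    have eN : (N0 ℓ Mh k P μ : ℝ) = side (D.chart s).toDomains i * (Pj ℓ k P i.1.1 μ : ℝ) := by
      rw [N0_eq_mul_Pj hjk μ, side_eq]; push_cast; ring
    have hPj : (2 : ℝ) ≤ (Pj ℓ k P i.1.1 μ : ℝ) := by
      have h1 : 2 ≤ Pj ℓ k P i.1.1 μ := le_trans (hP2 μ) (Nat.le_mul_of_pos_left _ (one_le_rj (ℓ := ℓ) (k := k) _))
      exact_mod_cast h1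
    rw [eN]
    nlinarith [mul_le_mul_of_nonneg_left hPj hS.le]
  rw [ec, eS, esF, ew]
  exact (hprof_circR_eq hS h2S (hw μ)).symm

/-- **A CHART SITE THAT IS `S/2`-DEEP FOR A CUBE OF SIDE `2S` satisfies the hypothesis of `thetaF_chart_eq_thetaT`** (the centre lies in `[S/2, N₀ − S/2]`).
[cite: Balaban1984PropagatorsII, (2.36) p.229, bookkeeping] -/
theorem abs_sub_ctr_le_of_deep (hMh : 1 ≤ Mh) (D' : Domains d ℓ Mh k P R) (i : ↥(cubes D')) (w : ↥(boxDom (N0 ℓ Mh k P)))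
    (hw : ∀ μ, side D' i / 2 ≤ (w.1 μ : ℝ) ∧ (w.1 μ : ℝ) + side D' i / 2 ≤ N0 ℓ Mh k P μ) (μ : Fin (d + 1)) :
    |(w.1 μ : ℝ) - ctr D' i μ| ≤ (N0 ℓ Mh k P μ : ℝ) - side D' i := by
  obtain ⟨h1, h2⟩ := ctr_bounds D' hMh i μ
  obtain ⟨h3, h4⟩ := hw μ
  rw [abs_le]; constructor <;> linarith

/-- **… and EVERY box site satisfies it for a cube whose centre lies in `[S, N₀ − S]`.** [cite: Balaban1984PropagatorsII, (2.36) p.229, bookkeeping] -/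
theorem abs_sub_ctr_le_of_ctr (D' : Domains d ℓ Mh k P R) (i : ↥(cubes D'))
    (hc : ∀ μ, side D' i ≤ ctr D' i μ ∧ ctr D' i μ + side D' i ≤ N0 ℓ Mh k P μ) (w : ↥(boxDom (N0 ℓ Mh k P))) (μ : Fin (d + 1)) :
    |(w.1 μ : ℝ) - ctr D' i μ| ≤ (N0 ℓ Mh k P μ : ℝ) - side D' i := by
  obtain ⟨h1, h2⟩ := hc μ
  obtain ⟨h3, h4⟩ := (mem_boxDom.1 w.2) μ
  have h3r : (0 : ℝ) ≤ (w.1 μ : ℝ) := by exact_mod_cast h3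
  have h4r : (w.1 μ : ℝ) + 1 ≤ (N0 ℓ Mh k P μ : ℝ) := by
    have : w.1 μ + 1 ≤ (N0 ℓ Mh k P μ : ℤ) := by omega
    exact_mod_cast this
  rw [abs_le]; constructor <;> linarith

/-- every cube has side `S_j ≤ S_k = M·L^k`. [cite: Balaban1984PropagatorsII, (2.1) p.224, bookkeeping] -/
theorem side_le_bigSide_k (D' : Domains d ℓ Mh k P R) (i : ↥(cubes D')) : side D' i ≤ (bigSide ℓ Mh k : ℝ) := by
  have hjk : i.1.1 ≤ k := by
    obtain ⟨x, _, hx⟩ := Finset.mem_image.1 i.2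
    rw [← hx]; exact D'.lev_le x
  show (bigSide ℓ Mh i.1.1 : ℝ) ≤ (bigSide ℓ Mh k : ℝ)
  unfold bigSide
  exact_mod_cast Nat.mul_le_mul_left _ (Nat.pow_le_pow_right (by omega) (by omega))

/-- **THE NORMALISING SUMS AGREE AT EVERY `S_k/2`-DEEP CHART SITE**: `Σ_{□ ∈ cubes(chart)} θ_□(w)² = Σ_{□ ∈ cubes(torus)} θ^T_□(σ_s w)²` (term by term along
the label transport). [cite: Balaban1984PropagatorsII, (2.36) p.229, dictionary (charts)] -/
theorem nsqF_chart_eq_nsqT (hMh : 1 ≤ Mh) (hP2 : ∀ μ, 2 ≤ P μ) (s : Fin (d + 1) → ℤ) (w : ↥(boxDom (N0 ℓ Mh k P)))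
    (hw : ∀ μ, (bigSide ℓ Mh k : ℝ) / 2 ≤ (w.1 μ : ℝ) ∧ (w.1 μ : ℝ) + (bigSide ℓ Mh k : ℝ) / 2 ≤ N0 ℓ Mh k P μ) :
    nsqF (D.chart s).toDomains w = nsqT D (tshift (N0 ℓ Mh k P) (TDomains.tvec ℓ Mh k s) w) := by
  have hP : ∀ μ, 1 ≤ P μ := fun μ => le_trans (by norm_num) (hP2 μ)
  unfold nsqF nsqT
  rw [← Equiv.sum_comp (cubesEquiv D hMh hP s)]
  refine Finset.sum_congr rfl fun i _ => ?_
  rw [cubesEquiv_apply_val]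
  congr 1
  refine thetaF_chart_eq_thetaT hMh hP2 s i w fun μ => abs_sub_ctr_le_of_deep hMh _ i w (fun ν => ?_) μ
  have hS := side_le_bigSide_k (D.chart s).toDomains i
  obtain ⟨h1, h2⟩ := hw ν
  constructor <;> linarith

/-- **A CUBE IS DEEP IN THE CHART**: its centre is at least `S + S_k/2` from every wall of the fundamental box (so its bump agrees with the periodic bump
everywhere, and its support consists of `S_k/2`-deep sites). [cite: Balaban1984PropagatorsII, (2.36) p.229, dictionary (charts)] -/
def CtrDeep (D' : Domains d ℓ Mh k P R) (i : ↥(cubes D')) : Prop :=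
  ∀ μ, side D' i + (bigSide ℓ Mh k : ℝ) / 2 ≤ ctr D' i μ ∧ ctr D' i μ + side D' i + (bigSide ℓ Mh k : ℝ) / 2 ≤ N0 ℓ Mh k P μ

/-- **THE DICTIONARY**: for EVERY chart `s` and every cube `□` of the chart family whose centre is `(S + S_k/2)`-deep, gen 25's box function `h_□` read at a
chart site IS the periodic `h^T` of the transported cube at the translated site: `hF (D.chart s).toDomains □ w = hT D (cT s □) (σ_s w)` for ALL `w`.
[cite: Balaban1984PropagatorsII, (2.36) p.229 («T_η = ⋃_{□∈𝒟} □ … Σ_{□∈𝒟} h_□² = 1»); Balaban1984PropagatorsI, (1.118) p.36] -/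
theorem hF_chart_eq_hT (hMh : 1 ≤ Mh) (hP2 : ∀ μ, 2 ≤ P μ) (s : Fin (d + 1) → ℤ) (i : ↥(cubes (D.chart s).toDomains))
    (hdeep : CtrDeep (D.chart s).toDomains i) (w : ↥(boxDom (N0 ℓ Mh k P))) :
    hF (D.chart s).toDomains i w = hT D (cubesEquiv D hMh (fun μ => le_trans (by norm_num) (hP2 μ)) s i) (tshift (N0 ℓ Mh k P) (TDomains.tvec ℓ Mh k s) w) := by
  have hP : ∀ μ, 1 ≤ P μ := fun μ => le_trans (by norm_num) (hP2 μ)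
  have hS : 0 < side (D.chart s).toDomains i := side_pos _ hMh i
  have hSk : (0 : ℝ) ≤ (bigSide ℓ Mh k : ℝ) := by positivity
  have hθ : thetaF (D.chart s).toDomains i (toR w.1) =
      thetaT ℓ Mh (N0 ℓ Mh k P) (cT ℓ k P s i.1) (tshift (N0 ℓ Mh k P) (TDomains.tvec ℓ Mh k s) w).1 :=
    thetaF_chart_eq_thetaT hMh hP2 s i w (abs_sub_ctr_le_of_ctr _ i (fun μ => by
      obtain ⟨h1, h2⟩ := hdeep μ; constructor <;> linarith) w)
  unfold hF hT
  rw [cubesEquiv_apply_val, ← hθ]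
  by_cases h0 : thetaF (D.chart s).toDomains i (toR w.1) = 0
  · rw [h0, zero_div, zero_div]
  · -- on the support the site is `S_k/2`-deep, where the normalising sums agree
    have hdist := dist_lt_of_thetaF_ne_zero (D.chart s).toDomains hMh h0
    rw [nsqF_chart_eq_nsqT hMh hP2 s w fun μ => ?_]
    have hμ := (dist_le_pi_dist (toR w.1) (ctr (D.chart s).toDomains i) μ).trans hdist.le
    rw [Real.dist_eq, abs_le] at hμ
    have ew : toR w.1 μ = (w.1 μ : ℝ) := rfl
    rw [ew] at hμ
    obtain ⟨h1, h2⟩ := hdeep μ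
    constructor <;> linarith [hμ.1, hμ.2]

/-- **THE SAME, READ FROM THE TORUS** (gen 25's `pullT` form, the input shape of `…B6TorusDepthDistance.lip_transfer`): `hT D (cT s □) = pullT s (hF (D.chart s) □)`,
i.e. `hT D (cT s □) z = hF (D.chart s).toDomains □ (σ_s⁻¹ z)` for every torus site `z`. [cite: Balaban1984PropagatorsII, (2.36) p.229, dictionary (charts)] -/
theorem hT_eq_hF_chart_symm (hMh : 1 ≤ Mh) (hP2 : ∀ μ, 2 ≤ P μ) (s : Fin (d + 1) → ℤ) (i : ↥(cubes (D.chart s).toDomains))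
    (hdeep : CtrDeep (D.chart s).toDomains i) (z : ↥(boxDom (N0 ℓ Mh k P))) :
    hT D (cubesEquiv D hMh (fun μ => le_trans (by norm_num) (hP2 μ)) s i) z =
      hF (D.chart s).toDomains i ((tshift (N0 ℓ Mh k P) (TDomains.tvec ℓ Mh k s)).symm z) := by
  rw [hF_chart_eq_hT hMh hP2 s i hdeep, Equiv.apply_symm_apply]

end Chart

end Literature.MathematicalPhysics.QuantumFieldTheory.Balaban1983to89.B6Partition118KLevelTorusChart
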